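import Mathlib
import HarnessLib
import Literature.MathematicalPhysics.StatisticalMechanics.PolymerNorms
import Summits.HubbardSuperconductivity.HubbardSuperconductivity.Theorems.ComplexGFFStiffnessHypACumulantHolomorphicTaylorNorm

/-!
# Crux `HypACumulant`, line `gnv` — Lipschitz and parallelogram bounds of the POLYMER NORMS
# `‖·‖_k^{(A)}`, `‖·‖_{k:k+1}^{(A)}` along holomorphic families of activities, from a sup bound alone

Route `route-HubbardSuperconductivity-ComplexGFFStiffness`, cruxes stmt-HubbardSuperconductivity-19154 /
-19155, shared research statement `OnePointLipschitz`, census (C3d′): the polymer-norm form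
([ABKM19] (6.48)–(6.50), the tree's predicates `WeakNormLE`, `MidNormLE`) of
`…HypACumulantHolomorphicTaylorNorm`.  For a family of polymer activities `K_σ(X, φ)` indexed by a complex
parameter in a disc (or two parameters in a bidisc), jointly `C^∞` in `(σ, φ)` and holomorphic in `σ` for
each `(X, φ)`, a UNIFORM norm bound `‖K_σ‖ ≤ C` on the disc gives
`‖K_σ − K_0‖ ≤ (r₀+1)(2C/R)|σ|` and `‖K_{σ,τ} − K_{σ,0} − K_{0,τ} + K_{0,0}‖ ≤ (r₀+1)(4C/R²)|σ||τ|`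
in the same norm (`weakNormLE_sub_of_holomorphic`, `weakNormLE_secondDiff_of_holomorphic`, and the
`MidNormLE` twins).  These are the `(H, K)`-slot Lipschitz and second-difference estimates of the
renormalisation maps once the maps are known to be entire in `(H, K)` with the zeroth-order bound of
[ABKM19] Theorem 6.8 on a complex ball.  Pure bookkeeping; all proved, no `sorry`.

## References
* S. Adams, S. Buchholz, R. Kotecký, S. Müller, arXiv:1910.13564, Ch. 6.4 (6.48)–(6.50), Ch. 10–11
  [AdamsBuchholzKoteckyMuller2019].
-/

noncomputable section

-- `Summit.<Summit>.<Problem>`: single-conjunct summit, the duplicate component is mandated (D-0017).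
set_option linter.dupNamespace false

namespace Summit.HubbardSuperconductivity.HubbardSuperconductivity.Theorems.ComplexGFF

open Metric Set
open Literature.MathematicalPhysics.StatisticalMechanics.GradientRG
open Literature.MathematicalPhysics.StatisticalMechanics.TorusPolymer (IsPolymer)
open Literature.Barriers.CriticalPhenomena.LongRangePhi4.Polymer (IsConn)

variable {d M : ℕ} [NeZero M]

/-- **Lipschitz bound of the weak polymer norm along a holomorphic family of activities.** -/
theorem weakNormLE_sub_of_holomorphic (P : NormParams d M) (k : ℕ)
    {K : ℂ → Finset (Fin d → ZMod M) → ((Fin d → ZMod M) → ℝ) → ℂ} {R C : ℝ}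
    (hK : ∀ X, ContDiff ℝ (⊤ : WithTop ℕ∞) (fun p : ℂ × ((Fin d → ZMod M) → ℝ) => K p.1 X p.2))
    (hhol : ∀ X ψ, DifferentiableOn ℂ (fun σ => K σ X ψ) (ball (0 : ℂ) R))
    (hC : ∀ σ ∈ ball (0 : ℂ) R, WeakNormLE P k (K σ) C) {σ : ℂ} (hσ : σ ∈ ball (0 : ℂ) R) :
    WeakNormLE P k (fun X ψ => K σ X ψ - K 0 X ψ) (((P.r₀ : ℝ) + 1) * (2 * C / R) * ‖σ‖) := by
  intro X hX hXc
  have h := tayNormLE_sub_of_holomorphic (P.gauge k X) P.r₀ (P.W.weight k X) (K := fun σ ψ => K σ X ψ)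
    (C := C * P.aFactor k X) (hK X) (hhol X) (fun σ' hσ' => hC σ' hσ' X hX hXc) hσ
  have e : ((P.r₀ : ℝ) + 1) * (2 * (C * P.aFactor k X) / R) * ‖σ‖
      = ((P.r₀ : ℝ) + 1) * (2 * C / R) * ‖σ‖ * P.aFactor k X := by ring
  rw [e] at h
  exact h

/-- **Parallelogram bound of the weak polymer norm along a two-parameter holomorphic family.** -/
theorem weakNormLE_secondDiff_of_holomorphic (P : NormParams d M) (k : ℕ)
    {K : ℂ → ℂ → Finset (Fin d → ZMod M) → ((Fin d → ZMod M) → ℝ) → ℂ} {R C : ℝ}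
    (hKσ : ∀ τ X, ContDiff ℝ (⊤ : WithTop ℕ∞) (fun p : ℂ × ((Fin d → ZMod M) → ℝ) => K p.1 τ X p.2))
    (hKτ : ∀ σ X, ContDiff ℝ (⊤ : WithTop ℕ∞) (fun p : ℂ × ((Fin d → ZMod M) → ℝ) => K σ p.1 X p.2))
    (hholσ : ∀ τ ∈ ball (0 : ℂ) R, ∀ X ψ, DifferentiableOn ℂ (fun σ => K σ τ X ψ) (ball (0 : ℂ) R))
    (hholτ : ∀ σ ∈ ball (0 : ℂ) R, ∀ X ψ, DifferentiableOn ℂ (fun τ => K σ τ X ψ) (ball (0 : ℂ) R))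
    (hC : ∀ σ ∈ ball (0 : ℂ) R, ∀ τ ∈ ball (0 : ℂ) R, WeakNormLE P k (K σ τ) C)
    {σ τ : ℂ} (hσ : σ ∈ ball (0 : ℂ) R) (hτ : τ ∈ ball (0 : ℂ) R) :
    WeakNormLE P k (fun X ψ => K σ τ X ψ - K σ 0 X ψ - K 0 τ X ψ + K 0 0 X ψ)
      (((P.r₀ : ℝ) + 1) * (4 * C / R ^ 2) * ‖σ‖ * ‖τ‖) := by
  intro X hX hXc
  have h := tayNormLE_secondDiff_of_holomorphic (P.gauge k X) P.r₀ (P.W.weight k X) (K := fun σ τ ψ => K σ τ X ψ)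
    (C := C * P.aFactor k X) (fun τ' => hKσ τ' X) (fun σ' => hKτ σ' X)
    (fun τ' hτ' ψ => hholσ τ' hτ' X ψ) (fun σ' hσ' ψ => hholτ σ' hσ' X ψ)
    (fun σ' hσ' τ' hτ' => hC σ' hσ' τ' hτ' X hX hXc) hσ hτ
  have e : ((P.r₀ : ℝ) + 1) * (4 * (C * P.aFactor k X) / R ^ 2) * ‖σ‖ * ‖τ‖
      = ((P.r₀ : ℝ) + 1) * (4 * C / R ^ 2) * ‖σ‖ * ‖τ‖ * P.aFactor k X := by ring
  rw [e] at h
  exact h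

/-- **Lipschitz bound of the intermediate polymer norm `‖·‖_{k:k+1}` along a holomorphic family.** -/
theorem midNormLE_sub_of_holomorphic (P : NormParams d M) (k : ℕ)
    {K : ℂ → Finset (Fin d → ZMod M) → ((Fin d → ZMod M) → ℝ) → ℂ} {R C : ℝ}
    (hK : ∀ X, ContDiff ℝ (⊤ : WithTop ℕ∞) (fun p : ℂ × ((Fin d → ZMod M) → ℝ) => K p.1 X p.2))
    (hhol : ∀ X ψ, DifferentiableOn ℂ (fun σ => K σ X ψ) (ball (0 : ℂ) R))
    (hC : ∀ σ ∈ ball (0 : ℂ) R, MidNormLE P k (K σ) C) {σ : ℂ} (hσ : σ ∈ ball (0 : ℂ) R) :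
    MidNormLE P k (fun X ψ => K σ X ψ - K 0 X ψ) (((P.r₀ : ℝ) + 1) * (2 * C / R) * ‖σ‖) := by
  intro X hX hXc
  have h := tayNormLE_sub_of_holomorphic (P.gauge k X) P.r₀ (P.W.midWeight k X) (K := fun σ ψ => K σ X ψ)
    (C := C * P.aFactor k X) (hK X) (hhol X) (fun σ' hσ' => hC σ' hσ' X hX hXc) hσ
  have e : ((P.r₀ : ℝ) + 1) * (2 * (C * P.aFactor k X) / R) * ‖σ‖
      = ((P.r₀ : ℝ) + 1) * (2 * C / R) * ‖σ‖ * P.aFactor k X := by ring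
  rw [e] at h
  exact h

/-- **Parallelogram bound of the intermediate polymer norm along a two-parameter holomorphic family.** -/
theorem midNormLE_secondDiff_of_holomorphic (P : NormParams d M) (k : ℕ)
    {K : ℂ → ℂ → Finset (Fin d → ZMod M) → ((Fin d → ZMod M) → ℝ) → ℂ} {R C : ℝ}
    (hKσ : ∀ τ X, ContDiff ℝ (⊤ : WithTop ℕ∞) (fun p : ℂ × ((Fin d → ZMod M) → ℝ) => K p.1 τ X p.2))
    (hKτ : ∀ σ X, ContDiff ℝ (⊤ : WithTop ℕ∞) (fun p : ℂ × ((Fin d → ZMod M) → ℝ) => K σ p.1 X p.2))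
    (hholσ : ∀ τ ∈ ball (0 : ℂ) R, ∀ X ψ, DifferentiableOn ℂ (fun σ => K σ τ X ψ) (ball (0 : ℂ) R))
    (hholτ : ∀ σ ∈ ball (0 : ℂ) R, ∀ X ψ, DifferentiableOn ℂ (fun τ => K σ τ X ψ) (ball (0 : ℂ) R))
    (hC : ∀ σ ∈ ball (0 : ℂ) R, ∀ τ ∈ ball (0 : ℂ) R, MidNormLE P k (K σ τ) C)
    {σ τ : ℂ} (hσ : σ ∈ ball (0 : ℂ) R) (hτ : τ ∈ ball (0 : ℂ) R) :
    MidNormLE P k (fun X ψ => K σ τ X ψ - K σ 0 X ψ - K 0 τ X ψ + K 0 0 X ψ)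
      (((P.r₀ : ℝ) + 1) * (4 * C / R ^ 2) * ‖σ‖ * ‖τ‖) := by
  intro X hX hXc
  have h := tayNormLE_secondDiff_of_holomorphic (P.gauge k X) P.r₀ (P.W.midWeight k X) (K := fun σ τ ψ => K σ τ X ψ)
    (C := C * P.aFactor k X) (fun τ' => hKσ τ' X) (fun σ' => hKτ σ' X)
    (fun τ' hτ' ψ => hholσ τ' hτ' X ψ) (fun σ' hσ' ψ => hholτ σ' hσ' X ψ)
    (fun σ' hσ' τ' hτ' => hC σ' hσ' τ' hτ' X hX hXc) hσ hτ
  have e : ((P.r₀ : ℝ) + 1) * (4 * (C * P.aFactor k X) / R ^ 2) * ‖σ‖ * ‖τ‖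
      = ((P.r₀ : ℝ) + 1) * (4 * C / R ^ 2) * ‖σ‖ * ‖τ‖ * P.aFactor k X := by ring
  rw [e] at h
  exact h

end Summit.HubbardSuperconductivity.HubbardSuperconductivity.Theorems.ComplexGFF

end
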